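import Summits.ResolutionOfSingularities.ResolutionOfSingularities.Theses.UniversalCells
import Literature.AlgebraicGeometry.Resolution.PrincipalizationToResolution
import Literature.AlgebraicGeometry.Resolution.ResolutionOfCurves
import Literature.AlgebraicGeometry.Resolution.ProjectiveSpaceRegular
import Summits.ResolutionOfSingularities.ResolutionOfSingularities.Theorems.UniversalCellsMatroidCellResStubRegularPointLocalRes
import Summits.ResolutionOfSingularities.ResolutionOfSingularities.Theorems.UniversalCellsMatroidCellResStubCurveLocalRes
import Literature.AlgebraicGeometry.Resolution.HuGammaSchemeResolution
import Summits.ResolutionOfSingularities.ResolutionOfSingularities.Theorems.UniversalCellsMatroidCellResStubAffineNbhd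
import Summits.ResolutionOfSingularities.ResolutionOfSingularities.Theorems.UniversalCellsMatroidCellResStubSaturateAway
import Summits.ResolutionOfSingularities.ResolutionOfSingularities.Theorems.UniversalCellsMatroidCellResChartReduction
import Summits.ResolutionOfSingularities.ResolutionOfSingularities.Theorems.UniversalCellsMatroidCellResChartEquivalence
import Summits.ResolutionOfSingularities.ResolutionOfSingularities.Theorems.UniversalCellsMatroidCellResSingularClosedPoints
import HarnessLib

/-!
# Crux `MatroidCellRes` (stmt-ResolutionOfSingularities-15230) — line `birth`, RESHAPE 4e (saturated affine charts; stubs = Hu's claim by name + LOCAL resolution at the singular closed points of the residual charts)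

Route `ResolutionOfSingularities/UniversalCells`, crux #2 (rank 2, difficulty open-problem):
`MatroidCellRes` = "for every prime `p`, every `m`, every finite set `Γ₊` and every set `Γ₀` of
column triples, every INTEGRAL scheme `W` with an open immersion into the partial matroid stratum
`P(p,m,Γ₊,Γ₀) = Spec ((𝔽_p[a_ij : 3 × m] ⧸ (3 × 3 minors of [I₃ | A] indexed by Γ₀))[1 / ∏_{Γ₊} minors])`
is locally resolvable: every `w ∈ W` has an open neighbourhood with a resolution".

## RESHAPE 4 (continuation lead prover-line-stmt-ResolutionOfSingularities-15230-c1-0, 2026-08-17)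

History (first lead, reshapes 1–3b, registered sha 6462809f): `(R) regular points [LANDED p148615]
→ (C) curves [LANDED p148601] → (H) Hu 2025 Thm 1.3 BY NAME (Literature claim, p149368) → (S″) the
residue "singular germs with NO local integral Γ-chart" → MatroidCellRes`. The crux disprover
(`Cruxes/MatroidCellRes/Disproof.lean` §6, `LocalFoldIn`) then assessed (S″) as NOT vacuous —
matroid varieties `Z_{nb(M)}` of rigid configurations carry the extra rank-`≤ 1` component `R₁`
(`minor_eval_rankOne_eq_zero`), so integral Γ-schemes are scarce and the hypothesis `hnochart` is
satisfiable — and recommended, with the crux strategist (STRATEGY-CENSUS §Strengthen S⁺₁, §6 nudges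
1–2), re-cutting along the hypotheses Hu's PROOF actually consumes (Lemma 7.3, footnote p. 58:
integrality of the scheme being transformed + SATURATION "`x_u ≡ 0 ⇒ u ∈ Γ`"), after which the
residue is an explicit affine statement instead of a negated existential over all charts.

RESHAPE 4 does exactly that. Every instance `(W, w)` of the crux is moved onto a SATURATED INTEGRAL
PRINCIPAL AFFINE CHART by two provable glue stubs, and the engine is asked only on such charts:

* (A) `stub_affineNbhd` — PROVABLE (basic opens form a basis; an open of an integral scheme is
  integral): `w` has an open neighbourhood `U` with an open immersion `U → Spec (Q_{Γ₀})_f` into a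
  principal open of the Γ-scheme whose ring `(Q_{Γ₀})_f` is a domain (take `D(f) ∋ j(w)` inside the
  open image `j(W)`; then `U := j⁻¹ D(f) ≅ D(f)`).
* (B) `stub_saturateAway` — PROVABLE (pure commutative algebra: localisation commutes with
  quotients): for every `f : Q_{Γ₀}` there are `Γ ⊇ Γ₀` (namely `Γ = {u : x_u = 0 in (Q_{Γ₀})_f}`),
  `g : Q_Γ` (the image of `f`) and a ring isomorphism `(Q_{Γ₀})_f ≃+* (Q_Γ)_g` such that `Γ` is
  SATURATED on the chart: `u ∉ Γ ⇒ x_u ≠ 0 in (Q_Γ)_g`. This is the strategist's (N2)+(N3).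
* (H) `stub_hu2025Thm13 : Hu2025IntegralGammaSchemeResolution` — Hu's Thm. 1.3 BY NAME (Literature
  claim p149368, unchanged): it resolves the chart whenever the WHOLE Γ-scheme `Z_Γ = Spec Q_Γ` is
  integral (restriction of a resolution of `Z_Γ` to the open `D(g)`, proved in the composition).
* (N) `stub_saturatedEngineNonintegral` — THE RESIDUE, open: a saturated integral principal open
  `Spec (Q_Γ)_g` of a NON-integral Γ-scheme `Z_Γ` has a resolution. This is Hu's theorem LOCALISED:
  the strategist's `SaturatedEngine` S⁺₁ minus its Hu-verbatim sub-case; by STRATEGY-CENSUS §S⁺₁ it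
  is what Hu's chart-local argument would give if Part I is correct, but it is NOT in print, hence a
  stub and not a Literature fact. Non-vacuous: the disprover's rigid configurations (thin cell of
  dimension `m + 2` next to `R₁`) give integral saturated charts `D(x_u) ⊆ Z_{nb(M)}` of
  non-integral `Z_{nb(M)}`; by Lafforgue's universality (Hu 2025 Thm 9.4) these charts carry every
  singularity type of finite type over `𝔽_p` up to `𝔸ʳ`, so (N) is crux-sized (= the summit over
  `𝔽_p` up to `ProductDescent`), exactly like (H).

`MatroidCellRes_of : (A) → (B) → Hu2025IntegralGammaSchemeResolution → (N) → MatroidCellRes` is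
PROVED (axioms propext / Classical.choice / Quot.sound): compose `i` with the localisation open
immersion `P(p,m,Γ₊,Γ₀) → Z_{Γ₀}`; take the chart of (A) and saturate it by (B); resolve
`Spec (Q_Γ)_g` by (H) (if `Q_Γ` is a domain) or (N) (otherwise); transport the resolution back along
the open immersion `U → Spec (Q_{Γ₀})_f ≅ Spec (Q_Γ)_g` (`Scheme.HasResolution.of_isOpenImmersion`).
After (A) and (B) land the skeleton is CLOSED MODULO {Hu2025 Thm 1.3 (claim, by name), (N)}; the old
residue (S″) and the landed calibrations (R), (C) are no longer hypotheses of the composition ((R) and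
(C) stay recorded below as landed theorems; they are the regular-point and curve cases of (N) too).

## RESHAPE 4c (continuation lead prover-line-stmt-ResolutionOfSingularities-15230-c2-0, 2026-08-17)

One honest sharpening of the residue: the chart `Spec (Q_Γ)_g` is a reduced, separated `𝔽_p`-scheme
of finite type, so its case of (topological Krull) dimension `≤ 3` is the refereed theorem of
Cossart–Piltant (2019, Thm. 1.1), in tree as the NAMED FACT
`Literature.AlgebraicGeometry.Resolution.CossartPiltant2019` (users take it as a hypothesis;
`hasResolution_of_dim_le_three`); `hasResolution_away_of_dim_le_three` (proved) disposes of
`dim ≤ 3` on the chart GIVEN that fact, after which the residue is literally the open frontier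
(barrier `Literature.Barriers.ResolutionOfSingularities.DimensionFourFrontier`): "a SINGULAR saturated
integral principal open, of dimension `≥ 4`, of a Γ-scheme over `𝔽_p` has a resolution". Lead c2
registered that cut with (CP) as a third `sorry`'d stub (sha f4b1b5b2).

## RESHAPE 4d (continuation lead prover-line-stmt-ResolutionOfSingularities-15230-c3-0, 2026-08-17)

Back to the shape the route planner re-registered for this seat (sha 48044fba501a = lead c1's 4b):
the STUBS are exactly {(H) `stub_hu2025Thm13`, (N) `stub_saturatedEngineNonintegral` with
`¬ topologicalKrullDim ≤ 1`}, and `MatroidCellRes_of : Hu2025IntegralGammaSchemeResolution → (N) →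
MatroidCellRes` is PROVED (sorries 2 = {(H) claim by name, (N) open}). The glue (A), (B) is no
longer a hypothesis of anything: this seat LANDED the chart reduction under `Theorems/`
(`UniversalCellsMatroidCellResChartReduction.lean`, p158618: `matroidCellRes_of_chartEngine`,
`matroidCellRes_of_saturatedEngine` — crux ⇐ engine on singular saturated integral charts of
dimension `≥ 2`, unconditional, (A) and (B) inside — and `saturatedEngine_of_resolutionOfSingularities`;
`UniversalCellsMatroidCellResChartReductionNamed.lean`, p159203: `matroidCellRes_of_hu2025_of_residue`
= this composition, `matroidCellRes_of_cossartPiltant_of_saturatedEngineDimGeFour`,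
`matroidCellRes_of_hu2025_of_cossartPiltant_of_residueDimGeFour`), and the compositions below APPLY
the tree theorem to the stubs by name. Cossart–Piltant's theorem is no longer a `sorry`'d stub
(nobody proves a 250-page refereed theorem as a "stub"); it is a HYPOTHESIS of the sharper
alternative compositions, all proved with no `sorry` of their own: `saturatedEngine_of_cossartPiltant`
((CP) ∧ S⁺₁(dim ≥ 4) ⇒ S⁺(dim ≥ 2)) and `MatroidCellRes_of_saturatedEngineDimGeFour : CossartPiltant2019
→ S⁺₁(dim ≥ 4) → MatroidCellRes`. So the two honest readings of the residue coexist: UNCONDITIONALLY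
the crux is closed modulo {(H), (N) = singular saturated integral charts of dim ≥ 2 of non-integral
Γ-schemes}, and modulo the refereed (CP) the residue is the dim-≥-4 frontier; a promoted engine item
(signature `Sig.saturatedEngine` or `Sig.saturatedEngineDimGeFour`) is consumed by a one-line skeleton.

Why (N) does not fold into (H) inside the family (closing the line-internal repair question; details
`Cruxes/MatroidCellRes/LINE-STATUS-birth.md` §fold-in): a Γ'-scheme `Z_{Γ'}` (any number of extra
columns) that receives the chart `D(g) ⊆ Z_Γ` as an open compatibly with forgetting the extra columns
must have `Γ' ∩ (old triples) ⊆ Γ` by saturation, hence contains `J × {0}` for every other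
irreducible component `J` of `Z_Γ` (a zero column kills every minor through it), and `J × {0}` lies
outside the closure of the piece over `D(g)` (its projection `J` is not inside the component of
`D(g)`): `Z_{Γ'}` is reducible whenever `Z_Γ` is (an irreducible `Z_Γ` with embedded components off
the chart is not excluded by this argument; general open immersions `D(g) ↪ Z_{Γ'}` unrelated to a
column projection are the disprover's open question `LocalFoldIn`). Frame changes need all junk of
the projective Γ-scheme inside one Plücker hyperplane (lead c2). So the residue is not an artefact
of the column/frame presentation in any way this line can exploit.

**(N) IS NOT VACUOUS — proved in the tree** (lead c3, `Theorems/UniversalCellsMatroidCellResResidueWitness*.lean`,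
four files, `--supports` this crux): for the COMPLETE QUADRILATERAL `A₀ = [[1,1,1,0],[1,1,0,1],[1,0,1,1]]`
(`m = 4`, i.e. `n = 7`), `Γ = {u | x_u(A₀) = 0}`, `g = a₀₀`, and every prime `p ≠ 2`: the Γ-ring
`Q_Γ` is NOT a domain (`a₀₀ · (a₀₁a₁₃a₂₂ - a₁₁a₂₃a₀₂) = 0`, both factors `≠ 0`: the junk component
`c₀ = 0`), the chart `(Q_Γ)_g` IS a domain and is NOT a regular ring (it is the quadric cone
`a₁₀a₂₃ = a₁₃a₂₀` over `𝔾_m × 𝔸²`: explicit ring isomorphism, primality of a `2 × 2` determinant,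
Jacobian criterion at the vertex), `Γ` is saturated on it, and its dimension is `≥ 4` (a chain of
five primes from torus points). `Theorems.MatroidCellRes.stub_saturatedEngineNonintegral_hypotheses_satisfiable`
is the conjunction of the hypotheses of (N) in the registered vocabulary (with `¬ dim ≤ 1` AND
`¬ dim ≤ 3`), at `p = 3`. Consequence for the planner: the case split of `MatroidCellRes_of` invokes
(N) on actual inputs already at `n = 7`; Hu's Thm. 1.3 AS PRINTED (integral `Z_Γ`) does not close the
crux through this reduction, in any dimension cut — the localised engine S⁺ is genuinely needed.

## RESHAPE 4e (lead c3, 2026-08-17): the crux IS its chart form; the residue made pointwise, closed, singular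

Two further tree theorems of this seat turn the chart reduction into EQUIVALENCES
(`Theorems/UniversalCellsMatroidCellResChartEquivalence.lean`, p165146:
`matroidCellRes_iff_chartLocallyResolvable` — `MatroidCellRes` ⇔ "every saturated integral principal
affine chart `Spec (Q_Γ)_g` is POINTWISE-LOCALLY resolvable", `⇒` because `Spec (Q_Γ)_g` is itself
an integral open of the stratum `P(p,m,∅,Γ) = Spec (Q_Γ)_1`; and
`Theorems/UniversalCellsMatroidCellResSingularClosedPoints.lean`:
`matroidCellRes_iff_singularClosedPointEngine` — ⇔ "on every such chart of dimension `≥ 2`, every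
SINGULAR CLOSED point has a resolvable open neighbourhood", the reductions being normalisation in
dimension `≤ 1`, Jacobson density of closed points (any open neighbourhood of a closed
specialisation `w₀` of `w` contains `w`) and the landed regular-point stub (R) applied to the
chart). Accordingly the residue stub is now

* (N′) `stub_singularClosedPointLocalRes` — for `p` prime, `Q_Γ` NOT a domain, `(Q_Γ)_g` a domain on
  which `Γ` is saturated, `¬ dim Spec (Q_Γ)_g ≤ 1`, and `w` a CLOSED point of `Spec (Q_Γ)_g` whose
  local ring is NOT regular: `w` has an open neighbourhood admitting a resolution.

It is implied by the old (N) (`singularClosedPointLocalRes_of_saturatedEngineNonintegral`: a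
singular stalk makes `(Q_Γ)_g` non-regular, and a global resolution restricts to `⊤`), so nothing
registered before is lost, and `MatroidCellRes_of : Hu2025IntegralGammaSchemeResolution → (N′) →
MatroidCellRes` is the tree theorem `matroidCellRes_of_hu2025_of_singularClosedPointResidue` applied
by name. By the two equivalences, (H-by-conclusion) ∧ (N′) is not merely sufficient: it PARTITIONS an
equivalent of the crux (by whether `Q_Γ` is a domain), so promoting (N′) to an item loses nothing and
over-claims nothing. (N′) is LOCAL RESOLUTION (local uniformisation-strength, Zariski-open
neighbourhood) near each singular closed point of a thin Hu cell — by Lafforgue/Lee–Vakil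
universality still every singularity type of finite type over `𝔽_p` up to `𝔸ʳ`, hence open; its
hypotheses are ALL satisfiable — proved in the tree
(`Theorems/UniversalCellsMatroidCellResResidueWitnessClosedPoint.lean`, p166718:
`stub_singularClosedPointLocalRes_hypotheses_satisfiable`, `p = 3`, `m = 4`, the complete
quadrilateral, `g = a₀₀`, `w` = the vertex of the cone chart: the kernel of evaluation there is a
maximal ideal, hence a closed point, with non-regular local ring by the Jacobian criterion).

All stub signatures are written over Mathlib only (the two `let`s of the crux, substituted), so stub
files under `Theorems/` need no vocabulary beyond Mathlib + Literature; `sig_*_iff` (`Iff.rfl`) read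
them over the named family `univMatrix`/`minor`/`gammaIdeal`/`GammaRing`.

## Sanity (all proved, no `sorry`)

`matroidCellRes_iff` — the crux IS the statement over the named family (`Iff.rfl`); `minor_frame` —
the frame minor is `1`; `isDomain_gammaRing_empty` — `Γ₀ = ∅` gives affine space (Hu's class is
inhabited); `not_isDomain_gammaRing_pair` — `Γ₀ = {(e₀,e₁,c₀),(e₀,c₀,c₁)}`, `m = 2`, gives the
reducible `{a₂₀ = 0, a₁₀a₂₁ = 0} ⊂ 𝔸⁶` (non-integral Γ-schemes exist already at `m = 2`).

Disproof used: `Cruxes/MatroidCellRes/Disproof.lean` (cdisprove, 2026-08-17T09:43Z): §2 summit ⇒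
crux even with `IsIntegral` weakened to `IsReduced` (so no stub here is refutable short of ¬summit);
§4 `IsOpenImmersion i` load-bearing (p149749) — the composition uses `i` through
`stratumToGamma`; §6 `LocalFoldIn` assessment ⇒ this reshape (S″ dropped, saturation adopted).
-/

noncomputable section

-- single-problem summit: the doubled namespace component `ResolutionOfSingularities` is forced
set_option linter.dupNamespace false

open CategoryTheory AlgebraicGeometry Literature.AlgebraicGeometry.Resolution
open Summit.ResolutionOfSingularities.ResolutionOfSingularities.Theses.UniversalCells (MatroidCellRes)

namespace Summit.ResolutionOfSingularities.ResolutionOfSingularities.Cruxes.MatroidCellRes.Lines.Birth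

/-! ## The universal family, named (definitionally the `let`s of the crux) -/

/-- The universal `3 × (3 + m)` matrix `[I₃ | A]` over `𝔽_p[a_ij]` (the frame-normalised chart
`p₁₂₃ ≠ 0` of `Gr(3, 3 + m)`). [cite: Hu2025, §2.1–2.2; LeeVakil2012, §2] -/
def univMatrix (p m : ℕ) :
    Matrix (Fin 3) (Fin 3 ⊕ Fin m) (MvPolynomial (Fin 3 × Fin m) (ZMod p)) :=
  Matrix.fromCols 1 (Matrix.of fun i j => MvPolynomial.X (i, j))

/-- The `3 × 3` minor of `[I₃ | A]` on the column triple `u` (= the de-homogenised Plücker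
coordinate `x_u` on the chart `p₁₂₃ ≠ 0`). [cite: Hu2025, §2.2] -/
def minor (p m : ℕ) (u : Fin 3 → Fin 3 ⊕ Fin m) : MvPolynomial (Fin 3 × Fin m) (ZMod p) :=
  ((univMatrix p m).submatrix id u).det

/-- The ideal of the Γ-scheme `Z_{Γ₀}`: the minors indexed by `Γ₀`. [cite: Hu2025, §1.5 (p. 8)] -/
def gammaIdeal (p m : ℕ) (Γ0 : Set (Fin 3 → Fin 3 ⊕ Fin m)) :
    Ideal (MvPolynomial (Fin 3 × Fin m) (ZMod p)) :=
  Ideal.span (minor p m '' Γ0)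

/-- Coordinate ring of the Γ-scheme `Z_{Γ₀} ⊆ 𝔸^{3m}_{𝔽_p}`. [cite: Hu2025, §1.5 (p. 8), §2.1 (p. 10)] -/
abbrev GammaRing (p m : ℕ) (Γ0 : Set (Fin 3 → Fin 3 ⊕ Fin m)) : Type :=
  MvPolynomial (Fin 3 × Fin m) (ZMod p) ⧸ gammaIdeal p m Γ0

/-- The image `x̄_u` of the minor `x_u` in the coordinate ring of `Z_{Γ₀}`. [folklore] -/
abbrev minorClass (p m : ℕ) (Γ0 : Set (Fin 3 → Fin 3 ⊕ Fin m)) (u : Fin 3 → Fin 3 ⊕ Fin m) :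
    GammaRing p m Γ0 :=
  Ideal.Quotient.mk (gammaIdeal p m Γ0) (minor p m u)

/-- The product of the minors indexed by `Γ₊`, in the coordinate ring of `Z_{Γ₀}`. [folklore] -/
def basisProduct (p m : ℕ) (Γp : Finset (Fin 3 → Fin 3 ⊕ Fin m))
    (Γ0 : Set (Fin 3 → Fin 3 ⊕ Fin m)) : GammaRing p m Γ0 :=
  Ideal.Quotient.mk (gammaIdeal p m Γ0) (∏ u ∈ Γp, minor p m u)

/-- Coordinate ring of the partial matroid stratum `P(p,m,Γ₊,Γ₀) = D(∏_{Γ₊} minors) ⊆ Z_{Γ₀}`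
(the target of the open immersion `i` in the crux). [folklore] -/
abbrev StratumRing (p m : ℕ) (Γp : Finset (Fin 3 → Fin 3 ⊕ Fin m))
    (Γ0 : Set (Fin 3 → Fin 3 ⊕ Fin m)) : Type :=
  Localization.Away (basisProduct p m Γp Γ0)

/-- The localisation map `P(p,m,Γ₊,Γ₀) → Z_{Γ₀}`. [folklore] -/
def stratumToGamma (p m : ℕ) (Γp : Finset (Fin 3 → Fin 3 ⊕ Fin m))
    (Γ0 : Set (Fin 3 → Fin 3 ⊕ Fin m)) :
    Spec (.of (StratumRing p m Γp Γ0)) ⟶ Spec (.of (GammaRing p m Γ0)) :=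
  Spec.map (CommRingCat.ofHom (algebraMap (GammaRing p m Γ0) (StratumRing p m Γp Γ0)))

/-- The stratum is a principal open of the Γ-scheme: the localisation map is an open immersion.
[folklore] -/
instance isOpenImmersion_stratumToGamma (p m : ℕ) (Γp : Finset (Fin 3 → Fin 3 ⊕ Fin m))
    (Γ0 : Set (Fin 3 → Fin 3 ⊕ Fin m)) : IsOpenImmersion (stratumToGamma p m Γp Γ0) :=
  IsOpenImmersion.of_isLocalization (basisProduct p m Γp Γ0)

/-! ## Sanity (proved): the definitions compute; integral AND non-integral Γ-schemes exist -/

/-- The frame minor `p₁₂₃` (columns `e₀, e₁, e₂` of `[I₃ | A]`) is `1`: the family lives on the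
chart `p₁₂₃ ≠ 0`, as in Hu's `𝕌 = (p_m ≠ 0)`. [cite: Hu2025, §2.2 (p. 10)] -/
theorem minor_frame (p m : ℕ) : minor p m Sum.inl = 1 := by
  unfold minor univMatrix
  have h : (Matrix.fromCols (1 : Matrix (Fin 3) (Fin 3) (MvPolynomial (Fin 3 × Fin m) (ZMod p)))
      (Matrix.of fun i j => MvPolynomial.X (i, j))).submatrix id Sum.inl = 1 := by
    ext i j
    simp [Matrix.submatrix_apply, Matrix.fromCols_apply_inl]
  rw [h, Matrix.det_one]

/-- With no vanishing conditions the Γ-scheme is affine `3m`-space over `𝔽_p`, whose coordinate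
ring is a domain — Hu's hypothesis class is inhabited (`Γ₀ = ∅`, every `p`, `m`). [folklore] -/
theorem isDomain_gammaRing_empty (p m : ℕ) [Fact p.Prime] :
    IsDomain (GammaRing p m (∅ : Set (Fin 3 → Fin 3 ⊕ Fin m))) := by
  have h : gammaIdeal p m (∅ : Set (Fin 3 → Fin 3 ⊕ Fin m)) = ⊥ := by
    simp [gammaIdeal]
  exact (Ideal.Quotient.isDomain_iff_prime _).mpr (h ▸ Ideal.isPrime_bot)

/-- The column triple `(e₀, e₁, c₀)` of a `3 × (3 + 2)` matrix `[I₃ | A]`. [folklore] -/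
def u₁ : Fin 3 → Fin 3 ⊕ Fin 2 := ![Sum.inl 0, Sum.inl 1, Sum.inr 0]

/-- The column triple `(e₀, c₀, c₁)` of a `3 × (3 + 2)` matrix `[I₃ | A]`. [folklore] -/
def u₂ : Fin 3 → Fin 3 ⊕ Fin 2 := ![Sum.inl 0, Sum.inr 0, Sum.inr 1]

/-- The minor on `(e₀, e₁, c₀)` is the entry `a₂₀`. [folklore] -/
theorem minor_u₁ (p : ℕ) : minor p 2 u₁ = MvPolynomial.X (2, 0) := by
  unfold minor univMatrix u₁
  simp [Matrix.det_fin_three, Matrix.submatrix_apply, Matrix.fromCols_apply_inl,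
    Matrix.fromCols_apply_inr]

/-- The minor on `(e₀, c₀, c₁)` is `a₁₀ a₂₁ - a₁₁ a₂₀`. [folklore] -/
theorem minor_u₂ (p : ℕ) :
    minor p 2 u₂ = MvPolynomial.X (1, 0) * MvPolynomial.X (2, 1)
      - MvPolynomial.X (1, 1) * MvPolynomial.X (2, 0) := by
  unfold minor univMatrix u₂
  simp [Matrix.det_fin_three, Matrix.submatrix_apply, Matrix.fromCols_apply_inl,
    Matrix.fromCols_apply_inr]

/-- **Non-integral Γ-schemes exist already at `m = 2`**: for `Γ₀ = {(e₀,e₁,c₀), (e₀,c₀,c₁)}` the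
Γ-scheme is `{a₂₀ = 0, a₁₀ a₂₁ - a₁₁ a₂₀ = 0} = {a₂₀ = a₁₀ = 0} ∪ {a₂₀ = a₂₁ = 0} ⊂ 𝔸⁶_{𝔽_p}` —
two components, so its coordinate ring is not a domain (`ā₁₀ · ā₂₁ = 0` with both factors
non-zero, witnessed by evaluation at indicator points). [folklore] -/
theorem not_isDomain_gammaRing_pair (p : ℕ) [Fact p.Prime] :
    ¬ IsDomain (GammaRing p 2 {u₁, u₂}) := by
  intro hdom
  set I : Ideal (MvPolynomial (Fin 3 × Fin 2) (ZMod p)) := gammaIdeal p 2 {u₁, u₂} with hIdef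
  have hI : I = Ideal.span {MvPolynomial.X (2, 0),
      MvPolynomial.X (1, 0) * MvPolynomial.X (2, 1) - MvPolynomial.X (1, 1) * MvPolynomial.X (2, 0)} := by
    simp [hIdef, gammaIdeal, Set.image_insert_eq, Set.image_singleton, minor_u₁, minor_u₂]
  have h20 : (MvPolynomial.X (2, 0) : MvPolynomial (Fin 3 × Fin 2) (ZMod p)) ∈ I :=
    hI ▸ Ideal.subset_span (by simp)
  have hg : (MvPolynomial.X (1, 0) * MvPolynomial.X (2, 1) - MvPolynomial.X (1, 1) *
      MvPolynomial.X (2, 0) : MvPolynomial (Fin 3 × Fin 2) (ZMod p)) ∈ I :=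
    hI ▸ Ideal.subset_span (by simp)
  -- `ā₁₀ · ā₂₁ = 0` in the quotient
  have hprod : Ideal.Quotient.mk I (MvPolynomial.X (1, 0)) *
      Ideal.Quotient.mk I (MvPolynomial.X (2, 1)) = 0 := by
    rw [← map_mul, Ideal.Quotient.eq_zero_iff_mem]
    have : (MvPolynomial.X (1, 0) * MvPolynomial.X (2, 1) : MvPolynomial (Fin 3 × Fin 2) (ZMod p)) =
        (MvPolynomial.X (1, 0) * MvPolynomial.X (2, 1) - MvPolynomial.X (1, 1) * MvPolynomial.X (2, 0))
          + MvPolynomial.X (1, 1) * MvPolynomial.X (2, 0) := by ring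
    rw [this]
    exact I.add_mem hg (I.mul_mem_left _ h20)
  -- both factors are non-zero: evaluate at the indicator of the variable
  have key : ∀ ij : Fin 3 × Fin 2, ij = (1, 0) ∨ ij = (2, 1) →
      Ideal.Quotient.mk I (MvPolynomial.X ij) ≠ 0 := by
    rintro ij hij h0
    rw [Ideal.Quotient.eq_zero_iff_mem] at h0
    let φ : MvPolynomial (Fin 3 × Fin 2) (ZMod p) →+* ZMod p :=
      MvPolynomial.eval (fun kl => if kl = ij then 1 else 0)
    have hφI : ∀ f ∈ I, φ f = 0 := by
      intro f hf
      rw [hI] at hf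
      refine Submodule.span_induction ?_ ?_ ?_ ?_ hf
      · rintro f hf'
        simp only [Set.mem_insert_iff, Set.mem_singleton_iff] at hf'
        rcases hf' with rfl | rfl
        · rcases hij with rfl | rfl <;> simp [φ]
        · rcases hij with rfl | rfl <;> simp [φ]
      · simp
      · intro a b _ _ ha hb
        simp [ha, hb]
      · intro a b _ hb
        simp [hb]
    have h1 := hφI _ h0
    rcases hij with rfl | rfl <;> simp [φ] at h1
  exact mul_ne_zero (key (1, 0) (Or.inl rfl)) (key (2, 1) (Or.inr rfl)) hprod

/-! ## Landed calibrations of reshape 1 (wave 1 of the first lead): regular points and curves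

These are the regular-point and `dim ≤ 1` cases of the crux, LANDED unconditionally; the reshape-4
composition no longer routes through them (they are also the first two cases anyone proving (N)
will dispose of, by `Scheme.IsRegular.hasResolution` / `hasResolution_of_dim_le_one`). -/

/-- **(R) regular points — LANDED** (p148615: `Theorems.MatroidCellRes.stub_regularPointLocalRes`,
`Theorems/UniversalCellsMatroidCellResStubRegularPointLocalRes.lean`). [cite: Matsumura1987, §30 Cor. to Thm. 30.5] -/
theorem stub_regularPointLocalRes (p : ℕ) (hp : p.Prime) (m : ℕ)
    (Γ0 : Set (Fin 3 → Fin 3 ⊕ Fin m)) (W : Scheme.{0})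
    (j : W ⟶ Spec (.of (
        MvPolynomial (Fin 3 × Fin m) (ZMod p) ⧸ Ideal.span ((fun u : Fin 3 → Fin 3 ⊕ Fin m => ((Matrix.fromCols (1 : Matrix (Fin 3) (Fin 3) (MvPolynomial (Fin 3 × Fin m) (ZMod p))) (Matrix.of fun i j => MvPolynomial.X (i, j))).submatrix id u).det) '' Γ0))))
    (hj : IsOpenImmersion j) (w : W) (hw : IsRegularLocalRing (W.presheaf.stalk w)) :
    ∃ W' : W.Opens, w ∈ W' ∧ Scheme.HasResolution (W' : Scheme.{0}) :=
  Theorems.MatroidCellRes.stub_regularPointLocalRes p hp m Γ0 W j hj w hw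

/-- **(C) curves — LANDED** (p148601: `Theorems.MatroidCellRes.stub_curveLocalRes`,
`Theorems/UniversalCellsMatroidCellResStubCurveLocalRes.lean`). [cite: Hartshorne1977, Ch. V Rem. 3.8.1] -/
theorem stub_curveLocalRes (p : ℕ) (hp : p.Prime) (m : ℕ)
    (Γ0 : Set (Fin 3 → Fin 3 ⊕ Fin m)) (W : Scheme.{0})
    (j : W ⟶ Spec (.of (
        MvPolynomial (Fin 3 × Fin m) (ZMod p) ⧸ Ideal.span ((fun u : Fin 3 → Fin 3 ⊕ Fin m => ((Matrix.fromCols (1 : Matrix (Fin 3) (Fin 3) (MvPolynomial (Fin 3 × Fin m) (ZMod p))) (Matrix.of fun i j => MvPolynomial.X (i, j))).submatrix id u).det) '' Γ0))))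
    (hj : IsOpenImmersion j) (hW : IsIntegral W) (hdim : topologicalKrullDim W ≤ 1) (w : W) :
    ∃ W' : W.Opens, w ∈ W' ∧ Scheme.HasResolution (W' : Scheme.{0}) :=
  Theorems.MatroidCellRes.stub_curveLocalRes p hp m Γ0 W j hj hW hdim w

/-! ## The stub STATEMENTS by name (`Sig.stub_<name>`; `MatroidCellRes_of` takes exactly these as
hypotheses, and each `theorem stub_<name>` below has literally this type, binders named) -/

/-- **(A) Saturated-chart glue, part 1: an integral principal affine chart around `w`** —
statement of `stub_affineNbhd`: if `j : W → Z_{Γ₀}` is an open immersion and `W` is integral,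
every `w ∈ W` has an open neighbourhood `U` with an open immersion into a principal open
`Spec (Q_{Γ₀})_f` of the Γ-scheme whose coordinate ring `(Q_{Γ₀})_f` is a domain (basic opens
`D(f) ∋ j(w)` inside the open `j(W)` form a neighbourhood basis; `j⁻¹ D(f) ≅ D(f)` is a non-empty
open of the integral `W`). [folklore] -/
def Sig.stub_affineNbhd : Prop :=
  ∀ (p m : ℕ) (Γ0 : Set (Fin 3 → Fin 3 ⊕ Fin m)),
    ∀ (W : Scheme.{0}) (j : W ⟶ Spec (.of (
        MvPolynomial (Fin 3 × Fin m) (ZMod p) ⧸ Ideal.span ((fun u : Fin 3 → Fin 3 ⊕ Fin m => ((Matrix.fromCols (1 : Matrix (Fin 3) (Fin 3) (MvPolynomial (Fin 3 × Fin m) (ZMod p))) (Matrix.of fun i j => MvPolynomial.X (i, j))).submatrix id u).det) '' Γ0)))),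
      IsOpenImmersion j → IsIntegral W → ∀ w : W,
        ∃ (f : MvPolynomial (Fin 3 × Fin m) (ZMod p) ⧸ Ideal.span ((fun u : Fin 3 → Fin 3 ⊕ Fin m => ((Matrix.fromCols (1 : Matrix (Fin 3) (Fin 3) (MvPolynomial (Fin 3 × Fin m) (ZMod p))) (Matrix.of fun i j => MvPolynomial.X (i, j))).submatrix id u).det) '' Γ0))
          (U : W.Opens) (e : (U : Scheme.{0}) ⟶ Spec (.of (Localization.Away f))),
          w ∈ U ∧ IsOpenImmersion e ∧ IsDomain (Localization.Away f)

/-- **(B) Saturated-chart glue, part 2: saturating a principal open** — statement of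
`stub_saturateAway` (pure commutative algebra): for every `f` in the coordinate ring `Q_{Γ₀}` of a
Γ-scheme with `(Q_{Γ₀})_f` a domain there are a set of triples `Γ` (namely
`{u : x_u = 0 in (Q_{Γ₀})_f} ⊇ Γ₀`), an element `g : Q_Γ` (the image of `f`) and a ring isomorphism
`(Q_{Γ₀})_f ≃+* (Q_Γ)_g` (localisation commutes with quotients, and the extra minors are already
`0` in `(Q_{Γ₀})_f`), such that `(Q_Γ)_g` is a domain and `Γ` is SATURATED on the chart:
`u ∉ Γ ⇒ x_u ≠ 0 in (Q_Γ)_g`. [folklore] -/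
def Sig.stub_saturateAway : Prop :=
  ∀ (p m : ℕ) (Γ0 : Set (Fin 3 → Fin 3 ⊕ Fin m))
    (f : MvPolynomial (Fin 3 × Fin m) (ZMod p) ⧸ Ideal.span ((fun u : Fin 3 → Fin 3 ⊕ Fin m => ((Matrix.fromCols (1 : Matrix (Fin 3) (Fin 3) (MvPolynomial (Fin 3 × Fin m) (ZMod p))) (Matrix.of fun i j => MvPolynomial.X (i, j))).submatrix id u).det) '' Γ0)),
    IsDomain (Localization.Away f) →
      ∃ (Γ : Set (Fin 3 → Fin 3 ⊕ Fin m))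
        (g : MvPolynomial (Fin 3 × Fin m) (ZMod p) ⧸ Ideal.span ((fun u : Fin 3 → Fin 3 ⊕ Fin m => ((Matrix.fromCols (1 : Matrix (Fin 3) (Fin 3) (MvPolynomial (Fin 3 × Fin m) (ZMod p))) (Matrix.of fun i j => MvPolynomial.X (i, j))).submatrix id u).det) '' Γ))
        (_ : Localization.Away f ≃+* Localization.Away g),
        IsDomain (Localization.Away g) ∧
          ∀ u : Fin 3 → Fin 3 ⊕ Fin m, u ∉ Γ →
            algebraMap (MvPolynomial (Fin 3 × Fin m) (ZMod p) ⧸ Ideal.span ((fun u : Fin 3 → Fin 3 ⊕ Fin m => ((Matrix.fromCols (1 : Matrix (Fin 3) (Fin 3) (MvPolynomial (Fin 3 × Fin m) (ZMod p))) (Matrix.of fun i j => MvPolynomial.X (i, j))).submatrix id u).det) '' Γ)) (Localization.Away g)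
              (Ideal.Quotient.mk (Ideal.span ((fun u : Fin 3 → Fin 3 ⊕ Fin m => ((Matrix.fromCols (1 : Matrix (Fin 3) (Fin 3) (MvPolynomial (Fin 3 × Fin m) (ZMod p))) (Matrix.of fun i j => MvPolynomial.X (i, j))).submatrix id u).det) '' Γ))
                ((Matrix.fromCols (1 : Matrix (Fin 3) (Fin 3) (MvPolynomial (Fin 3 × Fin m) (ZMod p))) (Matrix.of fun i j => MvPolynomial.X (i, j))).submatrix id u).det) ≠ 0

/-- **(N) The OLD residue (RESHAPE 4b–4d; superseded by the weaker (N′) in RESHAPE 4e, kept because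
(N) ⇒ (N′) and the S⁺ compositions below consume it): Hu's theorem LOCALISED to a singular
saturated integral principal open, of dimension `≥ 2`, of a NON-integral Γ-scheme** — statement of
the former stub `stub_saturatedEngineNonintegral` (sha 48044fba501a): for a prime `p`, if `Q_Γ = 𝔽_p[A] ⧸ (Γ-minors)` is NOT a
domain but its localisation `(Q_Γ)_g` is, `Γ` is saturated on `D(g)` (`u ∉ Γ ⇒ x_u ≠ 0 in (Q_Γ)_g`),
`(Q_Γ)_g` is not a regular ring and `dim Spec (Q_Γ)_g ≥ 2` (the regular case and the curve case are
disposed of in the composition, unconditionally, by `Scheme.IsRegular.hasResolution` and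
`hasResolution_of_dim_le_one`), then `Spec (Q_Γ)_g` admits a resolution of singularities. Its
sub-case of dimension `≤ 3` is Cossart–Piltant's refereed theorem (named fact `CossartPiltant2019`,
not formalised; `saturatedEngine_of_cossartPiltant` below), so MODULO that fact the residue is the
dimension-`≥ 4` frontier (barrier `DimensionFourFrontier`).
The two structural hypotheses are exactly what Hu's proof of Thm. 1.3 consumes in its one use of
integrality (Lemma 7.3, footnote p. 58: "`x_u x_v` vanishes identically along `Z†`, hence so does
one of `x_u` and `x_v`, that is, `x_u` or `x_v ∈ Γ`, since `Z†` (birational to `Z_Γ`) is integral");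
the statement itself is not in print. OPEN, crux-sized: Lafforgue universality (in tree:
`UniversalCells.Universality_proof`) lands every finite-type singularity over `𝔽_p` in such charts
up to `𝔸ʳ`. [cite: Hu2025, Thm. 1.3 (p. 8) and Lemma 7.3 (p. 58); Lafforgue2003, Thm. I.14; CossartPiltant2019, Thm. 1.1] -/
def Sig.stub_saturatedEngineNonintegral : Prop :=
  ∀ p : ℕ, p.Prime → ∀ (m : ℕ) (Γ : Set (Fin 3 → Fin 3 ⊕ Fin m)),
    ¬ IsDomain (MvPolynomial (Fin 3 × Fin m) (ZMod p) ⧸ Ideal.span ((fun u : Fin 3 → Fin 3 ⊕ Fin m => ((Matrix.fromCols (1 : Matrix (Fin 3) (Fin 3) (MvPolynomial (Fin 3 × Fin m) (ZMod p))) (Matrix.of fun i j => MvPolynomial.X (i, j))).submatrix id u).det) '' Γ)) →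
    ∀ (g : MvPolynomial (Fin 3 × Fin m) (ZMod p) ⧸ Ideal.span ((fun u : Fin 3 → Fin 3 ⊕ Fin m => ((Matrix.fromCols (1 : Matrix (Fin 3) (Fin 3) (MvPolynomial (Fin 3 × Fin m) (ZMod p))) (Matrix.of fun i j => MvPolynomial.X (i, j))).submatrix id u).det) '' Γ)),
      IsDomain (Localization.Away g) →
        (∀ u : Fin 3 → Fin 3 ⊕ Fin m, u ∉ Γ →
            algebraMap (MvPolynomial (Fin 3 × Fin m) (ZMod p) ⧸ Ideal.span ((fun u : Fin 3 → Fin 3 ⊕ Fin m => ((Matrix.fromCols (1 : Matrix (Fin 3) (Fin 3) (MvPolynomial (Fin 3 × Fin m) (ZMod p))) (Matrix.of fun i j => MvPolynomial.X (i, j))).submatrix id u).det) '' Γ)) (Localization.Away g)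
              (Ideal.Quotient.mk (Ideal.span ((fun u : Fin 3 → Fin 3 ⊕ Fin m => ((Matrix.fromCols (1 : Matrix (Fin 3) (Fin 3) (MvPolynomial (Fin 3 × Fin m) (ZMod p))) (Matrix.of fun i j => MvPolynomial.X (i, j))).submatrix id u).det) '' Γ))
                ((Matrix.fromCols (1 : Matrix (Fin 3) (Fin 3) (MvPolynomial (Fin 3 × Fin m) (ZMod p))) (Matrix.of fun i j => MvPolynomial.X (i, j))).submatrix id u).det) ≠ 0) →
          ¬ IsRegularRing (Localization.Away g) →
            ¬ topologicalKrullDim (Spec (.of (Localization.Away g))) ≤ 1 →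
              Scheme.HasResolution (Spec (.of (Localization.Away g)))

/-- Signature of (N′) = `stub_singularClosedPointLocalRes` (THE RESIDUE, RESHAPE 4e, registered):
for a prime `p`, if `Q_Γ` is NOT a domain but `(Q_Γ)_g` is, `Γ` is saturated on `D(g)`,
`dim Spec (Q_Γ)_g ≥ 2`, and `w` is a CLOSED point of `Spec (Q_Γ)_g` with NON-regular local ring, then
`w` has an open neighbourhood in `Spec (Q_Γ)_g` admitting a resolution of singularities. Local
resolution near the singular closed points of thin Hu cells; OPEN (every finite-type singularity
over `𝔽_p` up to `𝔸ʳ`, by universality); implied by (N); with Hu's claim it closes the crux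
(`MatroidCellRes_of`), and with Hu's claim read by its conclusion it is EQUIVALENT to the crux's
non-integral half (`Theorems.MatroidCellRes.matroidCellRes_iff_singularClosedPointEngine`).
[cite: Hu2025, Thm. 1.3 (p. 8) and Lemma 7.3 (p. 58); Lafforgue2003, Thm. I.14] -/
def Sig.stub_singularClosedPointLocalRes : Prop :=
  ∀ p : ℕ, p.Prime → ∀ (m : ℕ) (Γ : Set (Fin 3 → Fin 3 ⊕ Fin m)),
    ¬ IsDomain (MvPolynomial (Fin 3 × Fin m) (ZMod p) ⧸ Ideal.span ((fun u : Fin 3 → Fin 3 ⊕ Fin m => ((Matrix.fromCols (1 : Matrix (Fin 3) (Fin 3) (MvPolynomial (Fin 3 × Fin m) (ZMod p))) (Matrix.of fun i j => MvPolynomial.X (i, j))).submatrix id u).det) '' Γ)) →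
    ∀ (g : MvPolynomial (Fin 3 × Fin m) (ZMod p) ⧸ Ideal.span ((fun u : Fin 3 → Fin 3 ⊕ Fin m => ((Matrix.fromCols (1 : Matrix (Fin 3) (Fin 3) (MvPolynomial (Fin 3 × Fin m) (ZMod p))) (Matrix.of fun i j => MvPolynomial.X (i, j))).submatrix id u).det) '' Γ)),
      IsDomain (Localization.Away g) →
        (∀ u : Fin 3 → Fin 3 ⊕ Fin m, u ∉ Γ →
            algebraMap (MvPolynomial (Fin 3 × Fin m) (ZMod p) ⧸ Ideal.span ((fun u : Fin 3 → Fin 3 ⊕ Fin m => ((Matrix.fromCols (1 : Matrix (Fin 3) (Fin 3) (MvPolynomial (Fin 3 × Fin m) (ZMod p))) (Matrix.of fun i j => MvPolynomial.X (i, j))).submatrix id u).det) '' Γ)) (Localization.Away g)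
              (Ideal.Quotient.mk (Ideal.span ((fun u : Fin 3 → Fin 3 ⊕ Fin m => ((Matrix.fromCols (1 : Matrix (Fin 3) (Fin 3) (MvPolynomial (Fin 3 × Fin m) (ZMod p))) (Matrix.of fun i j => MvPolynomial.X (i, j))).submatrix id u).det) '' Γ))
                ((Matrix.fromCols (1 : Matrix (Fin 3) (Fin 3) (MvPolynomial (Fin 3 × Fin m) (ZMod p))) (Matrix.of fun i j => MvPolynomial.X (i, j))).submatrix id u).det) ≠ 0) →
          ¬ topologicalKrullDim (Spec (.of (Localization.Away g))) ≤ 1 →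
            ∀ w : Spec (.of (Localization.Away g)),
              IsClosed ({w} : Set (Spec (.of (Localization.Away g)))) →
                ¬ IsRegularLocalRing ((Spec (.of (Localization.Away g))).presheaf.stalk w) →
                  ∃ W' : (Spec (.of (Localization.Away g))).Opens,
                    w ∈ W' ∧ Scheme.HasResolution (W' : Scheme.{0})

/-! ## The stubs (registered signatures: named binders over Mathlib only) -/

/-- **(A) — integral principal affine chart around a point — LANDED** (wave 1 of reshape 4,
p153751: `Theorems.MatroidCellRes.stub_affineNbhd`,
`Theorems/UniversalCellsMatroidCellResStubAffineNbhd.lean`). See `Sig.stub_affineNbhd`. [folklore] -/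
theorem stub_affineNbhd (p m : ℕ) (Γ0 : Set (Fin 3 → Fin 3 ⊕ Fin m)) (W : Scheme.{0})
    (j : W ⟶ Spec (.of (
        MvPolynomial (Fin 3 × Fin m) (ZMod p) ⧸ Ideal.span ((fun u : Fin 3 → Fin 3 ⊕ Fin m => ((Matrix.fromCols (1 : Matrix (Fin 3) (Fin 3) (MvPolynomial (Fin 3 × Fin m) (ZMod p))) (Matrix.of fun i j => MvPolynomial.X (i, j))).submatrix id u).det) '' Γ0))))
    (hj : IsOpenImmersion j) (hW : IsIntegral W) (w : W) :
    ∃ (f : MvPolynomial (Fin 3 × Fin m) (ZMod p) ⧸ Ideal.span ((fun u : Fin 3 → Fin 3 ⊕ Fin m => ((Matrix.fromCols (1 : Matrix (Fin 3) (Fin 3) (MvPolynomial (Fin 3 × Fin m) (ZMod p))) (Matrix.of fun i j => MvPolynomial.X (i, j))).submatrix id u).det) '' Γ0))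
      (U : W.Opens) (e : (U : Scheme.{0}) ⟶ Spec (.of (Localization.Away f))),
      w ∈ U ∧ IsOpenImmersion e ∧ IsDomain (Localization.Away f) :=
  Theorems.MatroidCellRes.stub_affineNbhd p m Γ0 W j hj hW w

/-- **(B) — saturating a principal open — LANDED** (wave 1 of reshape 4, p153762:
`Theorems.MatroidCellRes.stub_saturateAway` via the general `saturateAway_of_family`,
`Theorems/UniversalCellsMatroidCellResStubSaturateAway.lean`). See `Sig.stub_saturateAway`. [folklore] -/
theorem stub_saturateAway (p m : ℕ) (Γ0 : Set (Fin 3 → Fin 3 ⊕ Fin m))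
    (f : MvPolynomial (Fin 3 × Fin m) (ZMod p) ⧸ Ideal.span ((fun u : Fin 3 → Fin 3 ⊕ Fin m => ((Matrix.fromCols (1 : Matrix (Fin 3) (Fin 3) (MvPolynomial (Fin 3 × Fin m) (ZMod p))) (Matrix.of fun i j => MvPolynomial.X (i, j))).submatrix id u).det) '' Γ0))
    (hdom : IsDomain (Localization.Away f)) :
    ∃ (Γ : Set (Fin 3 → Fin 3 ⊕ Fin m))
      (g : MvPolynomial (Fin 3 × Fin m) (ZMod p) ⧸ Ideal.span ((fun u : Fin 3 → Fin 3 ⊕ Fin m => ((Matrix.fromCols (1 : Matrix (Fin 3) (Fin 3) (MvPolynomial (Fin 3 × Fin m) (ZMod p))) (Matrix.of fun i j => MvPolynomial.X (i, j))).submatrix id u).det) '' Γ))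
      (_ : Localization.Away f ≃+* Localization.Away g),
      IsDomain (Localization.Away g) ∧
        ∀ u : Fin 3 → Fin 3 ⊕ Fin m, u ∉ Γ →
          algebraMap (MvPolynomial (Fin 3 × Fin m) (ZMod p) ⧸ Ideal.span ((fun u : Fin 3 → Fin 3 ⊕ Fin m => ((Matrix.fromCols (1 : Matrix (Fin 3) (Fin 3) (MvPolynomial (Fin 3 × Fin m) (ZMod p))) (Matrix.of fun i j => MvPolynomial.X (i, j))).submatrix id u).det) '' Γ)) (Localization.Away g)
            (Ideal.Quotient.mk (Ideal.span ((fun u : Fin 3 → Fin 3 ⊕ Fin m => ((Matrix.fromCols (1 : Matrix (Fin 3) (Fin 3) (MvPolynomial (Fin 3 × Fin m) (ZMod p))) (Matrix.of fun i j => MvPolynomial.X (i, j))).submatrix id u).det) '' Γ))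
              ((Matrix.fromCols (1 : Matrix (Fin 3) (Fin 3) (MvPolynomial (Fin 3 × Fin m) (ZMod p))) (Matrix.of fun i j => MvPolynomial.X (i, j))).submatrix id u).det) ≠ 0 :=
  Theorems.MatroidCellRes.stub_saturateAway p m Γ0 f hdom

/-- **STUB (H), Hu's unrefereed Thm. 1.3 over `𝔽_p`, BY NAME; open — a Literature CLAIM.**
(`Literature.AlgebraicGeometry.Resolution.Hu2025IntegralGammaSchemeResolution`, D-0012
`@[claim "Hu2025" "under-review"]`, p149368.) Discharging this stub = verifying (or replacing) Hu's
`ϑ`/`℘`/`ℓ`-tower; `stub_integralGammaRes` below is PROVED from it by the Literature glue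
`Hu2025IntegralGammaSchemeResolution.hasResolution` (smooth over `Spec 𝔽_p` ⇒ regular).
[cite: Hu2025, Thm. 1.3 (p. 8)] -/
theorem stub_hu2025Thm13 :
    Literature.AlgebraicGeometry.Resolution.Hu2025IntegralGammaSchemeResolution := by
  sorry

/-- **(E) integral Γ-schemes over `𝔽_p` have resolutions — PROVED from (H)** (the claim, by name)
and the glue `Hu2025IntegralGammaSchemeResolution.hasResolution`; `HuGamma.ring (ZMod p) m Γ₀`
is by `rfl` the quotient ring written out here. [cite: Hu2025, Thm. 1.3 (p. 8)] -/
theorem stub_integralGammaRes (p : ℕ) (hp : p.Prime) (m : ℕ)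
    (Γ0 : Set (Fin 3 → Fin 3 ⊕ Fin m))
    (hdom : IsDomain (
        MvPolynomial (Fin 3 × Fin m) (ZMod p) ⧸ Ideal.span ((fun u : Fin 3 → Fin 3 ⊕ Fin m => ((Matrix.fromCols (1 : Matrix (Fin 3) (Fin 3) (MvPolynomial (Fin 3 × Fin m) (ZMod p))) (Matrix.of fun i j => MvPolynomial.X (i, j))).submatrix id u).det) '' Γ0))) :
    Scheme.HasResolution (Spec (.of (
        MvPolynomial (Fin 3 × Fin m) (ZMod p) ⧸ Ideal.span ((fun u : Fin 3 → Fin 3 ⊕ Fin m => ((Matrix.fromCols (1 : Matrix (Fin 3) (Fin 3) (MvPolynomial (Fin 3 × Fin m) (ZMod p))) (Matrix.of fun i j => MvPolynomial.X (i, j))).submatrix id u).det) '' Γ0)))) :=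
  haveI : Fact p.Prime := ⟨hp⟩
  Literature.AlgebraicGeometry.Resolution.Hu2025IntegralGammaSchemeResolution.hasResolution
    stub_hu2025Thm13 p m Γ0 hdom

/-- **STUB (N′), the residue (RESHAPE 4e); open — local resolution at a singular closed point of a
saturated integral principal chart, of dimension `≥ 2`, of a non-integral Γ-scheme over `𝔽_p`.**
See `Sig.stub_singularClosedPointLocalRes`. Not in print (Hu's Thm. 1.3 needs `Z_Γ` integral); by
universality it carries every finite-type singularity over `𝔽_p` up to `𝔸ʳ`.
[cite: Hu2025, Thm. 1.3 (p. 8) and Lemma 7.3 (p. 58); Lafforgue2003, Thm. I.14] -/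
theorem stub_singularClosedPointLocalRes (p : ℕ) (hp : p.Prime) (m : ℕ)
    (Γ : Set (Fin 3 → Fin 3 ⊕ Fin m))
    (hnd : ¬ IsDomain (MvPolynomial (Fin 3 × Fin m) (ZMod p) ⧸ Ideal.span ((fun u : Fin 3 → Fin 3 ⊕ Fin m => ((Matrix.fromCols (1 : Matrix (Fin 3) (Fin 3) (MvPolynomial (Fin 3 × Fin m) (ZMod p))) (Matrix.of fun i j => MvPolynomial.X (i, j))).submatrix id u).det) '' Γ)))
    (g : MvPolynomial (Fin 3 × Fin m) (ZMod p) ⧸ Ideal.span ((fun u : Fin 3 → Fin 3 ⊕ Fin m => ((Matrix.fromCols (1 : Matrix (Fin 3) (Fin 3) (MvPolynomial (Fin 3 × Fin m) (ZMod p))) (Matrix.of fun i j => MvPolynomial.X (i, j))).submatrix id u).det) '' Γ))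
    (hdom : IsDomain (Localization.Away g))
    (hsat : ∀ u : Fin 3 → Fin 3 ⊕ Fin m, u ∉ Γ →
        algebraMap (MvPolynomial (Fin 3 × Fin m) (ZMod p) ⧸ Ideal.span ((fun u : Fin 3 → Fin 3 ⊕ Fin m => ((Matrix.fromCols (1 : Matrix (Fin 3) (Fin 3) (MvPolynomial (Fin 3 × Fin m) (ZMod p))) (Matrix.of fun i j => MvPolynomial.X (i, j))).submatrix id u).det) '' Γ)) (Localization.Away g)
          (Ideal.Quotient.mk (Ideal.span ((fun u : Fin 3 → Fin 3 ⊕ Fin m => ((Matrix.fromCols (1 : Matrix (Fin 3) (Fin 3) (MvPolynomial (Fin 3 × Fin m) (ZMod p))) (Matrix.of fun i j => MvPolynomial.X (i, j))).submatrix id u).det) '' Γ))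
            ((Matrix.fromCols (1 : Matrix (Fin 3) (Fin 3) (MvPolynomial (Fin 3 × Fin m) (ZMod p))) (Matrix.of fun i j => MvPolynomial.X (i, j))).submatrix id u).det) ≠ 0)
    (hdim : ¬ topologicalKrullDim (Spec (.of (Localization.Away g))) ≤ 1)
    (w : Spec (.of (Localization.Away g)))
    (hw : IsClosed ({w} : Set (Spec (.of (Localization.Away g)))))
    (hsing : ¬ IsRegularLocalRing ((Spec (.of (Localization.Away g))).presheaf.stalk w)) :
    ∃ W' : (Spec (.of (Localization.Away g))).Opens,
      w ∈ W' ∧ Scheme.HasResolution (W' : Scheme.{0}) := by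
  sorry

/-- **(N) ⇒ (N′)** — the reshape only WEAKENED the residue: a singular stalk at `w` makes `(Q_Γ)_g`
a non-regular ring (`Scheme.isRegular_Spec`), so the old stub (N) resolves the whole chart, and a
resolution restricts to the open `⊤ ∋ w`. Hence any proof of the previously registered (N) still
closes the crux through `MatroidCellRes_of_residueN`. [folklore] -/
theorem singularClosedPointLocalRes_of_saturatedEngineNonintegral
    (hN : Sig.stub_saturatedEngineNonintegral) : Sig.stub_singularClosedPointLocalRes := by
  intro p hp m Γ hnd g hdom hsat hdim w _ hsing
  have hreg : ¬ IsRegularRing (Localization.Away g) := fun hR => by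
    haveI := hR
    exact hsing (Scheme.isRegular_Spec (.of (Localization.Away g)) w)
  exact ⟨⊤, TopologicalSpace.Opens.mem_top w, (hN p hp m Γ hnd g hdom hsat hreg hdim).restrict ⊤⟩

/-! ## The composition (kernel-checked; no `sorry` in its own term) -/

/-- **The crux over the named family** — `MatroidCellRes` with its two `let`s unfolded into
`univMatrix`/`minor`/`gammaIdeal`/`StratumRing`: a DEFINITIONAL restatement (`Iff.rfl`). [folklore] -/
theorem matroidCellRes_iff :
    MatroidCellRes ↔
      ∀ p : ℕ, p.Prime → ∀ (m : ℕ) (Γp : Finset (Fin 3 → Fin 3 ⊕ Fin m))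
        (Γ0 : Set (Fin 3 → Fin 3 ⊕ Fin m)) (W : Scheme.{0})
        (i : W ⟶ Spec (.of (StratumRing p m Γp Γ0))),
        IsOpenImmersion i → IsIntegral W →
          ∀ w : W, ∃ W' : W.Opens, w ∈ W' ∧ Scheme.HasResolution (W' : Scheme.{0}) :=
  Iff.rfl

/-- (A) read over the named family (`Iff.rfl`). [folklore] -/
theorem sig_affineNbhd_iff :
    Sig.stub_affineNbhd ↔
      ∀ (p m : ℕ) (Γ0 : Set (Fin 3 → Fin 3 ⊕ Fin m))
        (W : Scheme.{0}) (j : W ⟶ Spec (.of (GammaRing p m Γ0))),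
        IsOpenImmersion j → IsIntegral W → ∀ w : W,
          ∃ (f : GammaRing p m Γ0) (U : W.Opens)
            (e : (U : Scheme.{0}) ⟶ Spec (.of (Localization.Away f))),
            w ∈ U ∧ IsOpenImmersion e ∧ IsDomain (Localization.Away f) :=
  Iff.rfl

/-- (B) read over the named family (`Iff.rfl`). [folklore] -/
theorem sig_saturateAway_iff :
    Sig.stub_saturateAway ↔
      ∀ (p m : ℕ) (Γ0 : Set (Fin 3 → Fin 3 ⊕ Fin m)) (f : GammaRing p m Γ0),
        IsDomain (Localization.Away f) →
          ∃ (Γ : Set (Fin 3 → Fin 3 ⊕ Fin m)) (g : GammaRing p m Γ)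
            (_ : Localization.Away f ≃+* Localization.Away g),
            IsDomain (Localization.Away g) ∧
              ∀ u : Fin 3 → Fin 3 ⊕ Fin m, u ∉ Γ →
                algebraMap (GammaRing p m Γ) (Localization.Away g) (minorClass p m Γ u) ≠ 0 :=
  Iff.rfl

/-- (N) read over the named family (`Iff.rfl`). [folklore] -/
theorem sig_saturatedEngineNonintegral_iff :
    Sig.stub_saturatedEngineNonintegral ↔
      ∀ p : ℕ, p.Prime → ∀ (m : ℕ) (Γ : Set (Fin 3 → Fin 3 ⊕ Fin m)),
        ¬ IsDomain (GammaRing p m Γ) → ∀ g : GammaRing p m Γ, IsDomain (Localization.Away g) →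
          (∀ u : Fin 3 → Fin 3 ⊕ Fin m, u ∉ Γ →
              algebraMap (GammaRing p m Γ) (Localization.Away g) (minorClass p m Γ u) ≠ 0) →
            ¬ IsRegularRing (Localization.Away g) →
              ¬ topologicalKrullDim (Spec (.of (Localization.Away g))) ≤ 1 →
                Scheme.HasResolution (Spec (.of (Localization.Away g))) :=
  Iff.rfl

/-- (N′) read over the named family (`Iff.rfl`). [folklore] -/
theorem sig_singularClosedPointLocalRes_iff :
    Sig.stub_singularClosedPointLocalRes ↔
      ∀ p : ℕ, p.Prime → ∀ (m : ℕ) (Γ : Set (Fin 3 → Fin 3 ⊕ Fin m)),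
        ¬ IsDomain (GammaRing p m Γ) → ∀ g : GammaRing p m Γ, IsDomain (Localization.Away g) →
          (∀ u : Fin 3 → Fin 3 ⊕ Fin m, u ∉ Γ →
              algebraMap (GammaRing p m Γ) (Localization.Away g) (minorClass p m Γ u) ≠ 0) →
            ¬ topologicalKrullDim (Spec (.of (Localization.Away g))) ≤ 1 →
              ∀ w : Spec (.of (Localization.Away g)),
                IsClosed ({w} : Set (Spec (.of (Localization.Away g)))) →
                  ¬ IsRegularLocalRing ((Spec (.of (Localization.Away g))).presheaf.stalk w) →
                    ∃ W' : (Spec (.of (Localization.Away g))).Opens,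
                      w ∈ W' ∧ Scheme.HasResolution (W' : Scheme.{0}) :=
  Iff.rfl

/-- A principal open `Spec (Q_Γ)_g` of a Γ-scheme is locally of finite type over `𝔽_p`
(quotient of a polynomial ring in `3m` variables, then a localisation away from one element).
[folklore] -/
theorem locallyOfFiniteType_away (p m : ℕ) (I : Ideal (MvPolynomial (Fin 3 × Fin m) (ZMod p)))
    (g : MvPolynomial (Fin 3 × Fin m) (ZMod p) ⧸ I) :
    LocallyOfFiniteType
      (Spec.map (CommRingCat.ofHom (algebraMap (ZMod p) (Localization.Away g)))) := by
  rw [HasRingHomProperty.Spec_iff (P := @LocallyOfFiniteType)]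
  have h1 : (algebraMap (ZMod p) (MvPolynomial (Fin 3 × Fin m) (ZMod p) ⧸ I)).FiniteType :=
    RingHom.finiteType_algebraMap.mpr inferInstance
  have h2 : (algebraMap (MvPolynomial (Fin 3 × Fin m) (ZMod p) ⧸ I)
      (Localization.Away g)).FiniteType :=
    RingHom.finiteType_holdsForLocalizationAway (Localization.Away g) g
  have h := h2.comp h1
  rw [← IsScalarTower.algebraMap_eq] at h
  simpa using h

/-- **The curve case of the chart** (calibration (C) moved onto the chart): an integral principal
open `Spec (Q_Γ)_g` of dimension `≤ 1` has a resolution — normalisation of reduced curves of finite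
type over a field, proved in tree (`hasResolution_of_dim_le_one`). [cite: Hartshorne1977, Ch. V Rem. 3.8.1] -/
theorem hasResolution_away_of_dim_le_one (p : ℕ) [Fact p.Prime] (m : ℕ)
    (I : Ideal (MvPolynomial (Fin 3 × Fin m) (ZMod p)))
    (g : MvPolynomial (Fin 3 × Fin m) (ZMod p) ⧸ I) (hdom : IsDomain (Localization.Away g))
    (hdim : topologicalKrullDim (Spec (.of (Localization.Away g))) ≤ 1) :
    Scheme.HasResolution (Spec (.of (Localization.Away g))) := by
  haveI := locallyOfFiniteType_away p m I g
  haveI : _root_.IsReduced (Localization.Away g) := isReduced_of_noZeroDivisors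
  haveI : IsReduced (Spec (.of (Localization.Away g))) := inferInstance
  exact hasResolution_of_dim_le_one (Spec (.of (Localization.Away g)))
    (Spec.map (CommRingCat.ofHom (algebraMap (ZMod p) (Localization.Away g)))) hdim

/-- **The case of dimension `≤ 3` of the chart, from Cossart–Piltant BY NAME** (RESHAPE 4c): an
integral principal open `Spec (Q_Γ)_g` of a Γ-scheme over `𝔽_p` is a reduced, separated
`𝔽_p`-scheme of finite type (`locallyOfFiniteType_away`; affine, so separated and quasi-compact
over `Spec 𝔽_p`), so if its topological Krull dimension is `≤ 3` the named fact
`CossartPiltant2019` resolves it (`hasResolution_of_dim_le_three`). [cite: CossartPiltant2019, Thm. 1.1] -/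
theorem hasResolution_away_of_dim_le_three
    (hCP : Literature.AlgebraicGeometry.Resolution.CossartPiltant2019.{0})
    (p : ℕ) [Fact p.Prime] (m : ℕ) (I : Ideal (MvPolynomial (Fin 3 × Fin m) (ZMod p)))
    (g : MvPolynomial (Fin 3 × Fin m) (ZMod p) ⧸ I) (hdom : IsDomain (Localization.Away g))
    (hdim : topologicalKrullDim (Spec (.of (Localization.Away g))) ≤ 3) :
    Scheme.HasResolution (Spec (.of (Localization.Away g))) := by
  let f : Spec (.of (Localization.Away g)) ⟶ Spec (.of (ZMod p)) :=
    Spec.map (CommRingCat.ofHom (algebraMap (ZMod p) (Localization.Away g)))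
  haveI hft : LocallyOfFiniteType f := locallyOfFiniteType_away p m I g
  haveI : IsSeparated f := inferInstance
  haveI : QuasiCompact f := inferInstance
  haveI : _root_.IsReduced (Localization.Away g) := isReduced_of_noZeroDivisors
  haveI : IsReduced (Spec (.of (Localization.Away g))) := inferInstance
  exact hasResolution_of_dim_le_three hCP (p := p) (ZMod p) (Spec (.of (Localization.Away g))) f hdim

/-- **The regular case of the chart** (calibration (R) moved onto the chart): if `(Q_Γ)_g` is a
regular ring, `Spec (Q_Γ)_g` is its own resolution. [folklore] -/
theorem hasResolution_away_of_isRegularRing {R : Type} [CommRing R] (hreg : IsRegularRing R) :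
    Scheme.HasResolution (Spec (.of R)) :=
  Scheme.IsRegular.hasResolution (Scheme.isRegular_Spec (.of R))

/-- **Sanity: the summit resolves every integral principal open of a Γ-scheme over `𝔽_p`**
(it is a reduced, separated, finite-type `𝔽_p`-scheme, so `ResolutionInChar p` applies to it
directly). Hence the saturated engine S⁺₁, and in particular the residue stub (N), is
summit-implied: NO `stub-false` against (N) exists short of ¬`ResolutionOfSingularities`
(compare `Cruxes/MatroidCellRes/Disproof.lean` §2 for the crux itself). [folklore] -/
theorem hasResolution_away_of_summit (hS : _root_.ResolutionOfSingularities)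
    (p : ℕ) (hp : p.Prime) (m : ℕ) (I : Ideal (MvPolynomial (Fin 3 × Fin m) (ZMod p)))
    (g : MvPolynomial (Fin 3 × Fin m) (ZMod p) ⧸ I) (hdom : IsDomain (Localization.Away g)) :
    Scheme.HasResolution (Spec (.of (Localization.Away g))) := by
  haveI : Fact p.Prime := ⟨hp⟩
  let f : Spec (.of (Localization.Away g)) ⟶ Spec (.of (ZMod p)) :=
    Spec.map (CommRingCat.ofHom (algebraMap (ZMod p) (Localization.Away g)))
  haveI hft : LocallyOfFiniteType f := locallyOfFiniteType_away p m I g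
  haveI : IsSeparated f := inferInstance
  haveI : QuasiCompact f := inferInstance
  haveI : _root_.IsReduced (Localization.Away g) := isReduced_of_noZeroDivisors
  haveI : IsReduced (Spec (.of (Localization.Away g))) := inferInstance
  exact hS p hp (ZMod p) (Spec (.of (Localization.Away g))) f ‹_› ‹_› ‹_› ‹_›

/-- **(N) is summit-implied** (so it cannot be refuted short of ¬summit): the residue stub follows
from `ResolutionOfSingularities` by `hasResolution_away_of_summit`, ignoring both the
non-integrality and the saturation hypotheses. [folklore] -/
theorem saturatedEngineNonintegral_of_summit (hS : _root_.ResolutionOfSingularities) :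
    Sig.stub_saturatedEngineNonintegral :=
  fun p hp m _ _ g hdom _ _ _ => hasResolution_away_of_summit hS p hp m _ g hdom

/-- **A saturated integral principal open of an INTEGRAL Γ-scheme is resolved by Hu's claim**:
`Spec (Q_Γ)_g → Spec Q_Γ = Z_Γ` is an open immersion (localisation), and resolutions restrict to
opens (`Scheme.HasResolution.of_isOpenImmersion`). This is the sub-case of the strategist's
saturated engine S⁺₁ that Hu's Thm. 1.3 covers verbatim. [cite: Hu2025, Thm. 1.3 (p. 8)] -/
theorem hasResolution_away_of_isDomain
    (hH : Literature.AlgebraicGeometry.Resolution.Hu2025IntegralGammaSchemeResolution)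
    (p : ℕ) [Fact p.Prime] (m : ℕ) (Γ : Set (Fin 3 → Fin 3 ⊕ Fin m))
    (hQ : IsDomain (GammaRing p m Γ)) (g : GammaRing p m Γ) :
    Scheme.HasResolution (Spec (.of (Localization.Away g))) := by
  have h1 : Scheme.HasResolution (Spec (.of (GammaRing p m Γ))) :=
    Literature.AlgebraicGeometry.Resolution.Hu2025IntegralGammaSchemeResolution.hasResolution
      hH p m Γ hQ
  haveI : IsOpenImmersion
      (Spec.map (CommRingCat.ofHom (algebraMap (GammaRing p m Γ) (Localization.Away g)))) :=
    IsOpenImmersion.of_isLocalization g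
  exact Scheme.HasResolution.of_isOpenImmersion
    (Spec.map (CommRingCat.ofHom (algebraMap (GammaRing p m Γ) (Localization.Away g)))) h1

/-- **The chart reduction** (glue, PROVED): `MatroidCellRes` follows from (A), (B) and ANY chart
engine "every saturated integral principal open `Spec (Q_Γ)_g` of a Γ-scheme over `𝔽_p` has a
resolution": compose the open immersion `i : W → P(p,m,Γ₊,Γ₀)` with the localisation open
immersion `P(p,m,Γ₊,Γ₀) → Z_{Γ₀}` (so `Γ₊` disappears); (A) gives an open `U ∋ w` with an open
immersion `e : U → Spec (Q_{Γ₀})_f`, `(Q_{Γ₀})_f` a domain; (B) saturates: `(Q_{Γ₀})_f ≃+* (Q_Γ)_g`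
with `Γ` saturated on `D(g)`; the engine resolves `Spec (Q_Γ)_g`; the resolution transports back
along `U → Spec (Q_{Γ₀})_f ≅ Spec (Q_Γ)_g` (`Scheme.HasResolution.of_isOpenImmersion`), and `W' = U`.
(Concludes the crux in its named-family form, the right-hand side of `matroidCellRes_iff`, so that
`MatroidCellRes_of` stays the first theorem concluding `MatroidCellRes` by name.) [folklore] -/
theorem locallyResolvable_of_chartEngine (hA : Sig.stub_affineNbhd) (hB : Sig.stub_saturateAway)
    (hE : ∀ p : ℕ, p.Prime → ∀ (m : ℕ) (Γ : Set (Fin 3 → Fin 3 ⊕ Fin m)) (g : GammaRing p m Γ),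
      IsDomain (Localization.Away g) →
        (∀ u : Fin 3 → Fin 3 ⊕ Fin m, u ∉ Γ →
            algebraMap (GammaRing p m Γ) (Localization.Away g) (minorClass p m Γ u) ≠ 0) →
          Scheme.HasResolution (Spec (.of (Localization.Away g))))
    (p : ℕ) (hp : p.Prime) (m : ℕ) (Γp : Finset (Fin 3 → Fin 3 ⊕ Fin m))
    (Γ0 : Set (Fin 3 → Fin 3 ⊕ Fin m)) (W : Scheme.{0})
    (i : W ⟶ Spec (.of (StratumRing p m Γp Γ0))) (hi : IsOpenImmersion i) (hW : IsIntegral W)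
    (w : W) : ∃ W' : W.Opens, w ∈ W' ∧ Scheme.HasResolution (W' : Scheme.{0}) := by
  rw [sig_affineNbhd_iff] at hA
  rw [sig_saturateAway_iff] at hB
  classical
  haveI : Fact p.Prime := ⟨hp⟩
  haveI : IsOpenImmersion i := hi
  -- the composite open immersion `W → P(p,m,Γ₊,Γ₀) → Z_{Γ₀}`
  have hj : IsOpenImmersion (i ≫ stratumToGamma p m Γp Γ0) := inferInstance
  -- (A): an integral principal affine chart around `w`
  obtain ⟨f, U, e, hwU, he, hdomf⟩ := hA p m Γ0 W (i ≫ stratumToGamma p m Γp Γ0) hj hW w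
  -- (B): saturate it
  obtain ⟨Γ, g, eRing, hdomg, hsat⟩ := hB p m Γ0 f hdomf
  -- the engine resolves the saturated chart
  have hres : Scheme.HasResolution (Spec (.of (Localization.Away g))) := hE p hp m Γ g hdomg hsat
  -- transport back to `U` along `U → Spec (Q_{Γ₀})_f ≅ Spec (Q_Γ)_g`
  let ι : Spec (.of (Localization.Away f)) ⟶ Spec (.of (Localization.Away g)) :=
    Spec.map (eRing.symm.toCommRingCatIso).hom
  haveI : IsIso ι := inferInstance
  haveI : IsOpenImmersion e := he
  haveI : IsOpenImmersion (e ≫ ι) := inferInstance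
  exact ⟨U, hwU, Scheme.HasResolution.of_isOpenImmersion (e ≫ ι) hres⟩

/-! ## The SATURATED ENGINE (Hu's theorem localised), in the two honest cuts

`Sig.saturatedEngine` (S⁺, dimension `≥ 2`): "a singular saturated integral principal open
`Spec (Q_Γ)_g` of a Γ-scheme over `𝔽_p`, of dimension `≥ 2`, has a resolution" — NO hypothesis on
the whole `Z_Γ`; unconditionally it is exactly (H-case) ∧ (N) up to the peeled easy cases.
`Sig.saturatedEngineDimGeFour` (S⁺₁, dimension `≥ 4`): the same from dimension `4` on — what is left
of S⁺ modulo Cossart–Piltant's refereed theorem (`saturatedEngine_of_cossartPiltant`). Either is the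
recommended signature if the planner promotes the residue to an item (Hu's claim then enters only
a proof of the engine, not the assembly); `MatroidCellRes_of_saturatedEngine` /
`MatroidCellRes_of_saturatedEngineDimGeFour` are the compositions that consume them. -/

/-- **S⁺, the saturated engine from dimension 2** (Hu's Thm. 1.3 localised): for a prime `p`, every
`m`, `Γ` and `g : Q_Γ = 𝔽_p[A] ⧸ (Γ-minors)` with `(Q_Γ)_g` a domain on which `Γ` is saturated
(`u ∉ Γ ⇒ x_u ≠ 0 in (Q_Γ)_g`), `(Q_Γ)_g` not regular and `dim Spec (Q_Γ)_g ≥ 2`, the chart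
`Spec (Q_Γ)_g` has a resolution. OPEN (= (H-case) ∧ (N)); summit-implied.
[cite: Hu2025, Thm. 1.3 (p. 8) and Lemma 7.3 (p. 58); Lafforgue2003, Thm. I.14] -/
def Sig.saturatedEngine : Prop :=
  ∀ p : ℕ, p.Prime → ∀ (m : ℕ) (Γ : Set (Fin 3 → Fin 3 ⊕ Fin m))
    (g : MvPolynomial (Fin 3 × Fin m) (ZMod p) ⧸ Ideal.span ((fun u : Fin 3 → Fin 3 ⊕ Fin m => ((Matrix.fromCols (1 : Matrix (Fin 3) (Fin 3) (MvPolynomial (Fin 3 × Fin m) (ZMod p))) (Matrix.of fun i j => MvPolynomial.X (i, j))).submatrix id u).det) '' Γ)),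
      IsDomain (Localization.Away g) →
        (∀ u : Fin 3 → Fin 3 ⊕ Fin m, u ∉ Γ →
            algebraMap (MvPolynomial (Fin 3 × Fin m) (ZMod p) ⧸ Ideal.span ((fun u : Fin 3 → Fin 3 ⊕ Fin m => ((Matrix.fromCols (1 : Matrix (Fin 3) (Fin 3) (MvPolynomial (Fin 3 × Fin m) (ZMod p))) (Matrix.of fun i j => MvPolynomial.X (i, j))).submatrix id u).det) '' Γ)) (Localization.Away g)
              (Ideal.Quotient.mk (Ideal.span ((fun u : Fin 3 → Fin 3 ⊕ Fin m => ((Matrix.fromCols (1 : Matrix (Fin 3) (Fin 3) (MvPolynomial (Fin 3 × Fin m) (ZMod p))) (Matrix.of fun i j => MvPolynomial.X (i, j))).submatrix id u).det) '' Γ))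
                ((Matrix.fromCols (1 : Matrix (Fin 3) (Fin 3) (MvPolynomial (Fin 3 × Fin m) (ZMod p))) (Matrix.of fun i j => MvPolynomial.X (i, j))).submatrix id u).det) ≠ 0) →
          ¬ IsRegularRing (Localization.Away g) →
            ¬ topologicalKrullDim (Spec (.of (Localization.Away g))) ≤ 1 →
              Scheme.HasResolution (Spec (.of (Localization.Away g)))

/-- **S⁺₁, the saturated engine from dimension 4** (the open frontier on Hu's family): as
`Sig.saturatedEngine` with `dim Spec (Q_Γ)_g ≥ 4`. OPEN; summit-implied.
[cite: Hu2025, Thm. 1.3 (p. 8) and Lemma 7.3 (p. 58); CossartPiltant2019, Thm. 1.1] -/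
def Sig.saturatedEngineDimGeFour : Prop :=
  ∀ p : ℕ, p.Prime → ∀ (m : ℕ) (Γ : Set (Fin 3 → Fin 3 ⊕ Fin m))
    (g : MvPolynomial (Fin 3 × Fin m) (ZMod p) ⧸ Ideal.span ((fun u : Fin 3 → Fin 3 ⊕ Fin m => ((Matrix.fromCols (1 : Matrix (Fin 3) (Fin 3) (MvPolynomial (Fin 3 × Fin m) (ZMod p))) (Matrix.of fun i j => MvPolynomial.X (i, j))).submatrix id u).det) '' Γ)),
      IsDomain (Localization.Away g) →
        (∀ u : Fin 3 → Fin 3 ⊕ Fin m, u ∉ Γ →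
            algebraMap (MvPolynomial (Fin 3 × Fin m) (ZMod p) ⧸ Ideal.span ((fun u : Fin 3 → Fin 3 ⊕ Fin m => ((Matrix.fromCols (1 : Matrix (Fin 3) (Fin 3) (MvPolynomial (Fin 3 × Fin m) (ZMod p))) (Matrix.of fun i j => MvPolynomial.X (i, j))).submatrix id u).det) '' Γ)) (Localization.Away g)
              (Ideal.Quotient.mk (Ideal.span ((fun u : Fin 3 → Fin 3 ⊕ Fin m => ((Matrix.fromCols (1 : Matrix (Fin 3) (Fin 3) (MvPolynomial (Fin 3 × Fin m) (ZMod p))) (Matrix.of fun i j => MvPolynomial.X (i, j))).submatrix id u).det) '' Γ))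
                ((Matrix.fromCols (1 : Matrix (Fin 3) (Fin 3) (MvPolynomial (Fin 3 × Fin m) (ZMod p))) (Matrix.of fun i j => MvPolynomial.X (i, j))).submatrix id u).det) ≠ 0) →
          ¬ IsRegularRing (Localization.Away g) →
            ¬ topologicalKrullDim (Spec (.of (Localization.Away g))) ≤ 3 →
              Scheme.HasResolution (Spec (.of (Localization.Away g)))

/-- S⁺ read over the named family (`Iff.rfl`). [folklore] -/
theorem sig_saturatedEngine_iff :
    Sig.saturatedEngine ↔
      ∀ p : ℕ, p.Prime → ∀ (m : ℕ) (Γ : Set (Fin 3 → Fin 3 ⊕ Fin m)) (g : GammaRing p m Γ),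
        IsDomain (Localization.Away g) →
          (∀ u : Fin 3 → Fin 3 ⊕ Fin m, u ∉ Γ →
              algebraMap (GammaRing p m Γ) (Localization.Away g) (minorClass p m Γ u) ≠ 0) →
            ¬ IsRegularRing (Localization.Away g) →
              ¬ topologicalKrullDim (Spec (.of (Localization.Away g))) ≤ 1 →
                Scheme.HasResolution (Spec (.of (Localization.Away g))) :=
  Iff.rfl

/-- S⁺₁ read over the named family (`Iff.rfl`). [folklore] -/
theorem sig_saturatedEngineDimGeFour_iff :
    Sig.saturatedEngineDimGeFour ↔
      ∀ p : ℕ, p.Prime → ∀ (m : ℕ) (Γ : Set (Fin 3 → Fin 3 ⊕ Fin m)) (g : GammaRing p m Γ),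
        IsDomain (Localization.Away g) →
          (∀ u : Fin 3 → Fin 3 ⊕ Fin m, u ∉ Γ →
              algebraMap (GammaRing p m Γ) (Localization.Away g) (minorClass p m Γ u) ≠ 0) →
            ¬ IsRegularRing (Localization.Away g) →
              ¬ topologicalKrullDim (Spec (.of (Localization.Away g))) ≤ 3 →
                Scheme.HasResolution (Spec (.of (Localization.Away g))) :=
  Iff.rfl

/-- **S⁺ ⇒ (N)** (forget the non-integrality of `Z_Γ`). [folklore] -/
theorem saturatedEngineNonintegral_of_saturatedEngine (h : Sig.saturatedEngine) :
    Sig.stub_saturatedEngineNonintegral :=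
  fun p hp m Γ _ g hdom hsat hsing hdim => h p hp m Γ g hdom hsat hsing hdim

/-- **(H) ∧ (N) ⇒ S⁺**: on a chart of an integral `Z_Γ` Hu's claim restricted to `D(g)`
(`hasResolution_away_of_isDomain`), otherwise the residue. So modulo Hu's printed claim the
residue (N) IS the saturated engine. [cite: Hu2025, Thm. 1.3 (p. 8)] -/
theorem saturatedEngine_of
    (hH : Literature.AlgebraicGeometry.Resolution.Hu2025IntegralGammaSchemeResolution)
    (hN : Sig.stub_saturatedEngineNonintegral) : Sig.saturatedEngine := by
  rw [sig_saturatedEngine_iff]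
  rw [sig_saturatedEngineNonintegral_iff] at hN
  intro p hp m Γ g hdom hsat hsing hdim
  haveI : Fact p.Prime := ⟨hp⟩
  by_cases hQ : IsDomain (GammaRing p m Γ)
  · exact hasResolution_away_of_isDomain hH p m Γ hQ g
  · exact hN p hp m Γ hQ g hdom hsat hsing hdim

/-- **(CP) ∧ S⁺₁ ⇒ S⁺**: charts of dimension `≤ 3` by Cossart–Piltant's theorem by name
(`hasResolution_away_of_dim_le_three`), charts of dimension `≥ 4` by S⁺₁. So MODULO the refereed
named fact the residue is the dimension-`≥ 4` frontier. [cite: CossartPiltant2019, Thm. 1.1] -/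
theorem saturatedEngine_of_cossartPiltant
    (hCP : Literature.AlgebraicGeometry.Resolution.CossartPiltant2019.{0})
    (hE : Sig.saturatedEngineDimGeFour) : Sig.saturatedEngine := by
  rw [sig_saturatedEngine_iff]
  rw [sig_saturatedEngineDimGeFour_iff] at hE
  intro p hp m Γ g hdom hsat hsing _
  haveI : Fact p.Prime := ⟨hp⟩
  by_cases hdim3 : topologicalKrullDim (Spec (.of (Localization.Away g))) ≤ 3
  · exact hasResolution_away_of_dim_le_three hCP p m (gammaIdeal p m Γ) g hdom hdim3
  · exact hE p hp m Γ g hdom hsat hsing hdim3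

/-- **S⁺ ⇒ S⁺₁** (a chart of dimension `≥ 4` has dimension `≥ 2`). [folklore] -/
theorem saturatedEngineDimGeFour_of_saturatedEngine (h : Sig.saturatedEngine) :
    Sig.saturatedEngineDimGeFour := by
  rw [sig_saturatedEngineDimGeFour_iff]
  rw [sig_saturatedEngine_iff] at h
  intro p hp m Γ g hdom hsat hsing hdim3
  refine h p hp m Γ g hdom hsat hsing fun hdim1 => hdim3 (hdim1.trans ?_)
  norm_num

/-- **S⁺ is summit-implied** (`hasResolution_away_of_summit`): no refutation short of ¬summit.
[folklore] -/
theorem saturatedEngine_of_summit (hS : _root_.ResolutionOfSingularities) : Sig.saturatedEngine :=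
  fun p hp m _ g hdom _ _ _ => hasResolution_away_of_summit hS p hp m _ g hdom

/-- **`MatroidCellRes` from (A), (B) and the saturated engine S⁺** — UNCONDITIONAL composition
inside this file (`locallyResolvable_of_chartEngine`; the chart resolved by itself when regular,
by normalisation in dimension `≤ 1`, by S⁺ otherwise). PROVED. Its tree form, with (A) and (B)
discharged by the landed stubs, is `Theorems.MatroidCellRes.matroidCellRes_of_saturatedEngine`
(p158618) — see `MatroidCellRes_of_saturatedEngine` below. [folklore] -/
theorem MatroidCellRes_of_glue_of_saturatedEngine :
    Sig.stub_affineNbhd → Sig.stub_saturateAway → Sig.saturatedEngine → MatroidCellRes := by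
  intro hA hB hE
  rw [sig_saturatedEngine_iff] at hE
  refine matroidCellRes_iff.mpr (locallyResolvable_of_chartEngine hA hB ?_)
  intro p hp m Γ g hdomg hsat
  haveI : Fact p.Prime := ⟨hp⟩
  by_cases hreg : IsRegularRing (Localization.Away g)
  · exact hasResolution_away_of_isRegularRing hreg
  by_cases hdim1 : topologicalKrullDim (Spec (.of (Localization.Away g))) ≤ 1
  · exact hasResolution_away_of_dim_le_one p m (gammaIdeal p m Γ) g hdomg hdim1
  · exact hE p hp m Γ g hdomg hsat hreg hdim1

/-! ## The compositions through the LANDED tree theorems (lead c3, p158618 + p159203)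

From here on the chart reduction is the TREE theorem
`Theorems.MatroidCellRes.matroidCellRes_of_saturatedEngine`
(`Theorems/UniversalCellsMatroidCellResChartReduction.lean`, p158618) applied to the engine BY NAME:
Lean checks on the spot that the registered Mathlib-only signature `Sig.saturatedEngine` is
definitionally the tree theorem's hypothesis (written over `tautMatrix`/`minorIdeal`). The named-fact
forms (claim ∧ (N) ⇒ crux; (CP) ∧ S⁺₁ ⇒ crux; claim ∧ (CP) ∧ (N, dim ≥ 4) ⇒ crux) are ALSO tree
theorems (`…ChartReductionNamed.lean`, p159203: `matroidCellRes_of_hu2025_of_residue`,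
`matroidCellRes_of_cossartPiltant_of_saturatedEngineDimGeFour`,
`matroidCellRes_of_hu2025_of_cossartPiltant_of_residueDimGeFour`); this workfile keeps its own
two-line versions so that it only imports the first file. So a future prover of (N) — or of a
promoted engine item with the signature `Sig.saturatedEngine` / `Sig.saturatedEngineDimGeFour` —
closes the crux with the corresponding one-liner. -/

/-- **`MatroidCellRes` ⇐ S⁺** (tree theorem `matroidCellRes_of_saturatedEngine`, p158618;
unconditional). [folklore] -/
theorem MatroidCellRes_of_saturatedEngine : Sig.saturatedEngine → MatroidCellRes :=
  fun hE => Theorems.MatroidCellRes.matroidCellRes_of_saturatedEngine hE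

/-- **`MatroidCellRes` ⇐ (CP) ∧ S⁺₁** (tree theorem
`matroidCellRes_of_cossartPiltant_of_saturatedEngineDimGeFour`, p159203; conditional on the named
fact `CossartPiltant2019`). [cite: CossartPiltant2019, Thm. 1.1] -/
theorem MatroidCellRes_of_saturatedEngineDimGeFour :
    Literature.AlgebraicGeometry.Resolution.CossartPiltant2019.{0} →
      Sig.saturatedEngineDimGeFour → MatroidCellRes :=
  fun hCP hE => MatroidCellRes_of_saturatedEngine (saturatedEngine_of_cossartPiltant hCP hE)

/-- **S⁺ is summit-implied, tree form** (`saturatedEngine_of_resolutionOfSingularities`, p158618).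
[folklore] -/
theorem saturatedEngine_of_summit' (hS : _root_.ResolutionOfSingularities) : Sig.saturatedEngine :=
  Theorems.MatroidCellRes.saturatedEngine_of_resolutionOfSingularities hS

/-! ## The composition (registered shape RESHAPE 4e: (A), (B) landed; (H), (N′) open) -/

/-- **`MatroidCellRes` from Hu's claim (H) by name and the old residue (N)** (RESHAPE 4d's assembly,
kept: (H) ∧ (N) give the saturated engine S⁺ (`saturatedEngine_of`), and the TREE theorem
`Theorems.MatroidCellRes.matroidCellRes_of_saturatedEngine` (p158618) does the rest; one-theorem
tree form `matroidCellRes_of_hu2025_of_residue`, p159203). [cite: Hu2025, Thm. 1.3 (p. 8)] -/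
theorem MatroidCellRes_of_residueN :
    Literature.AlgebraicGeometry.Resolution.Hu2025IntegralGammaSchemeResolution →
      Sig.stub_saturatedEngineNonintegral → MatroidCellRes :=
  fun hH hN => MatroidCellRes_of_saturatedEngine (saturatedEngine_of hH hN)

/-- The same composition kept inside this file (glue (A), (B) explicit), for the record.
[cite: Hu2025, Thm. 1.3 (p. 8)] -/
theorem MatroidCellRes_of_glue :
    Sig.stub_affineNbhd → Sig.stub_saturateAway →
      Literature.AlgebraicGeometry.Resolution.Hu2025IntegralGammaSchemeResolution →
        Sig.stub_saturatedEngineNonintegral → MatroidCellRes :=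
  fun hA hB hH hN => MatroidCellRes_of_glue_of_saturatedEngine hA hB (saturatedEngine_of hH hN)

/-- **The crux IS its chart form** (tree theorem `matroidCellRes_iff_chartLocallyResolvable`,
p165146): `MatroidCellRes` ⇔ pointwise-local resolvability of every saturated integral principal
affine chart. Recorded here so that the skeleton displays what the stubs partition. [folklore] -/
theorem MatroidCellRes_iff_chartLocallyResolvable :
    MatroidCellRes ↔
      ∀ p : ℕ, p.Prime → ∀ (m : ℕ) (Γ : Set (Fin 3 → Fin 3 ⊕ Fin m)) (g : GammaRing p m Γ),
        IsDomain (Localization.Away g) →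
          (∀ u : Fin 3 → Fin 3 ⊕ Fin m, u ∉ Γ →
              algebraMap (GammaRing p m Γ) (Localization.Away g) (minorClass p m Γ u) ≠ 0) →
            ∀ w : Spec (.of (Localization.Away g)),
              ∃ W' : (Spec (.of (Localization.Away g))).Opens,
                w ∈ W' ∧ Scheme.HasResolution (W' : Scheme.{0}) :=
  Theorems.MatroidCellRes.matroidCellRes_iff_chartLocallyResolvable

/-- **The crux IS the singular-closed-point engine** (tree theorem
`matroidCellRes_iff_singularClosedPointEngine`): `MatroidCellRes` ⇔ on every saturated integral
principal affine chart of dimension `≥ 2`, every singular closed point has a resolvable open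
neighbourhood. (H, read by its conclusion on charts) ∧ (N′) is exactly the right-hand side split by
whether `Q_Γ` is a domain. [folklore] -/
theorem MatroidCellRes_iff_singularClosedPointEngine :
    MatroidCellRes ↔
      ∀ p : ℕ, p.Prime → ∀ (m : ℕ) (Γ : Set (Fin 3 → Fin 3 ⊕ Fin m)) (g : GammaRing p m Γ),
        IsDomain (Localization.Away g) →
          (∀ u : Fin 3 → Fin 3 ⊕ Fin m, u ∉ Γ →
              algebraMap (GammaRing p m Γ) (Localization.Away g) (minorClass p m Γ u) ≠ 0) →
            ¬ topologicalKrullDim (Spec (.of (Localization.Away g))) ≤ 1 →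
              ∀ w : Spec (.of (Localization.Away g)),
                IsClosed ({w} : Set (Spec (.of (Localization.Away g)))) →
                  ¬ IsRegularLocalRing ((Spec (.of (Localization.Away g))).presheaf.stalk w) →
                    ∃ W' : (Spec (.of (Localization.Away g))).Opens,
                      w ∈ W' ∧ Scheme.HasResolution (W' : Scheme.{0}) :=
  Theorems.MatroidCellRes.matroidCellRes_iff_singularClosedPointEngine

/-- **`MatroidCellRes` from Hu's claim (H) by name and the residue (N′)** — THE ASSEMBLY (RESHAPE 4e),
PROVED: the tree theorem `Theorems.MatroidCellRes.matroidCellRes_of_hu2025_of_singularClosedPointResidue`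
(chart equivalence p165146 + normalisation in dimension `≤ 1` + Jacobson reduction to closed points +
the landed regular-point stub (R) + Hu's claim on the charts of integral Γ-schemes) applied to the
stubs BY NAME — Lean checks here that the registered Mathlib-only signature (N′) is definitionally
its residue hypothesis. Sorries in its closure: exactly (H) (claim) and (N′) (open).
[cite: Hu2025, Thm. 1.3 (p. 8)] -/
theorem MatroidCellRes_of :
    Literature.AlgebraicGeometry.Resolution.Hu2025IntegralGammaSchemeResolution →
      Sig.stub_singularClosedPointLocalRes → MatroidCellRes :=
  fun hH hN => Theorems.MatroidCellRes.matroidCellRes_of_hu2025_of_singularClosedPointResidue hH hN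

/-- (H) ∧ (N) still close the crux through the new assembly ((N) ⇒ (N′)). [folklore] -/
theorem MatroidCellRes_of_residueN' :
    Literature.AlgebraicGeometry.Resolution.Hu2025IntegralGammaSchemeResolution →
      Sig.stub_saturatedEngineNonintegral → MatroidCellRes :=
  fun hH hN => MatroidCellRes_of hH (singularClosedPointLocalRes_of_saturatedEngineNonintegral hN)

/-- **The crux `MatroidCellRes`, assembled from the registered stubs** (the skeleton in its
current shape: `MatroidCellRes_of` with the `stub_*` plugged in; the only `sorry`s in its closure
are the open stubs (H) and (N′), none of its own; everything else is in the tree). -/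
theorem MatroidCellRes_proof : MatroidCellRes :=
  MatroidCellRes_of stub_hu2025Thm13 stub_singularClosedPointLocalRes

end Summit.ResolutionOfSingularities.ResolutionOfSingularities.Cruxes.MatroidCellRes.Lines.Birth

end
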